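import Literature.Probability.LatticeModels.WeightedCurrentsSwitching
import HarnessLib

/-!
# Random currents with edge-dependent couplings: the Ising dictionary

Topic `Literature/Probability/LatticeModels`. For couplings `K : E(G) → ℝ`, `K ≥ 0`, on a finite simple
graph, **the Ising dictionary** (Panis 2023, §4.1, the two displays after Definition 4.1:
`Z(Λ,β) = 2^{|Λ|}∑_{∂n=∅} w_β(n)`, `⟨σ_A⟩_{Λ,β} = ∑_{∂n=A}w_β(n)/∑_{∂n=∅}w_β(n)`; Duminil-Copin 2016, eq. (2.2)):

`∑_σ σ_A ∏_{e ∈ E(G)} exp(K_e σ_e) = 2^{|V|} Z_K[A]`      (`sum_spinProduct_mul_prod_exp_eq`),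

with the same proof as the tree's uniform-`β` `sum_isingWeight_mul_spinProduct_eq` (`RandomCurrentsProofs.lean`:
box partial sums of the exponential series, the vertex sums `sum_spinProduct_mul_prod_bondSpin_pow`, uniqueness
of limits), plus the conversions between the real and `ℝ≥0∞` current sums (`ecurrentSum_eq_ofReal`,
`toReal_ecurrentSum`, finiteness, `0 < Z_K[∅]`) and `currentSum_eq_wcurrentSum` (the tree's uniform sum is
the weighted one of the constant coupling).

## References

* R. Panis, arXiv:2309.05797 (2023), §4.1 [Panis2023Triviality] (held; read p. 19).
* H. Duminil-Copin, arXiv:1607.06933 (2016), §2.1 eq. (2.2) [DuminilCopin2016].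
-/

noncomputable section

open Finset Filter Topology
open scoped symmDiff ENNReal

namespace Literature.Probability.LatticeModels

variable {V : Type*} [Fintype V] {G : SimpleGraph V} [DecidableRel G.Adj]

/-! ### The Ising dictionary `∑_σ σ_A ∏_e e^{K_e σ_e} = 2^{|V|} Z_K[A]` -/

section Dictionary

variable [DecidableEq V]

/-- The expansion of one configuration's weight over currents: the box partial sums
`∑_{n : n_e < N} w_K(n) ∏_e σ_e^{n_e}` tend to `∏_e e^{K_e σ_e}` (Panis 2023, §4.1: "if we use the expansion
`exp(βJ_{x,y}σ_xσ_y) = ∑_{n_{x,y} ≥ 0} (βJ_{x,y}σ_xσ_y)^{n_{x,y}}/n_{x,y}!`").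
[cite: Panis2023Triviality, §4.1] -/
theorem tendsto_sum_piFinset_wweight_mul_prod (K : G.edgeFinset → ℝ) (σ : SpinConfig V) :
    Tendsto (fun N : ℕ => ∑ n ∈ Fintype.piFinset (fun _ : G.edgeFinset => range N),
        Current.wweight K n * ∏ e : G.edgeFinset, bondSpin σ (e : Sym2 V) ^ n e) atTop
      (𝓝 (∏ e : G.edgeFinset, Real.exp (K e * bondSpin σ (e : Sym2 V)))) := by
  simp_rw [Current.sum_piFinset_wweight_mul K (fun e : G.edgeFinset => bondSpin σ (e : Sym2 V))]
  refine tendsto_finsetProd _ fun e _ => ?_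
  have h : HasSum (fun k : ℕ => (K e * bondSpin σ (e : Sym2 V)) ^ k / (k.factorial : ℝ))
      (Real.exp (K e * bondSpin σ (e : Sym2 V))) := by
    rw [Real.exp_eq_exp_ℝ]
    exact NormedSpace.expSeries_div_hasSum_exp (K e * bondSpin σ (e : Sym2 V))
  exact h.tendsto_sum_nat

/-- **The Ising dictionary** (Panis 2023, §4.1, the two displays after Definition 4.1:
`Z(Λ,β) = 2^{|Λ|}∑_{∂n=∅} w_β(n)` and `⟨σ_A⟩_{Λ,β} = ∑_{∂n=A}w_β(n)/∑_{∂n=∅}w_β(n)`; Duminil-Copin 2016,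
eq. (2.2)), for edge-dependent couplings `K ≥ 0`:
`∑_σ σ_A ∏_{e ∈ E(G)} exp(K_e σ_e) = 2^{|V|} Z_K[A]`. [cite: Panis2023Triviality, §4.1] -/
theorem sum_spinProduct_mul_prod_exp_eq {K : G.edgeFinset → ℝ} (hK : ∀ e, 0 ≤ K e) (A : Finset V) :
    ∑ σ : SpinConfig V, spinProduct A σ * ∏ e : G.edgeFinset, Real.exp (K e * bondSpin σ (e : Sym2 V)) =
      (2 : ℝ) ^ Fintype.card V * wcurrentSum K A := by
  have h1 : Tendsto (fun N : ℕ => ∑ σ : SpinConfig V, spinProduct A σ *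
      ∑ n ∈ Fintype.piFinset (fun _ : G.edgeFinset => range N),
        Current.wweight K n * ∏ e : G.edgeFinset, bondSpin σ (e : Sym2 V) ^ n e)
      atTop (𝓝 (∑ σ : SpinConfig V, spinProduct A σ *
        ∏ e : G.edgeFinset, Real.exp (K e * bondSpin σ (e : Sym2 V)))) :=
    tendsto_finsetSum _ fun σ _ => (tendsto_sum_piFinset_wweight_mul_prod K σ).const_mul _
  have h2 : Tendsto (fun N : ℕ => ∑ σ : SpinConfig V, spinProduct A σ *
      ∑ n ∈ Fintype.piFinset (fun _ : G.edgeFinset => range N),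
        Current.wweight K n * ∏ e : G.edgeFinset, bondSpin σ (e : Sym2 V) ^ n e)
      atTop (𝓝 ((2 : ℝ) ^ Fintype.card V * wcurrentSum K A)) := by
    have hre : ∀ N : ℕ, ∑ σ : SpinConfig V, spinProduct A σ *
        ∑ n ∈ Fintype.piFinset (fun _ : G.edgeFinset => range N),
          Current.wweight K n * ∏ e : G.edgeFinset, bondSpin σ (e : Sym2 V) ^ n e =
        (2 : ℝ) ^ Fintype.card V * ∑ n ∈ Fintype.piFinset (fun _ : G.edgeFinset => range N),
          (if Current.sources n = A then Current.wweight K n else 0) := by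
      intro N
      simp_rw [Finset.mul_sum]
      rw [Finset.sum_comm]
      refine Finset.sum_congr rfl fun n _ => ?_
      have h := sum_spinProduct_mul_prod_bondSpin_pow G A n
      calc ∑ σ : SpinConfig V, spinProduct A σ *
            (Current.wweight K n * ∏ e : G.edgeFinset, bondSpin σ (e : Sym2 V) ^ n e)
          = Current.wweight K n * ∑ σ : SpinConfig V, spinProduct A σ *
              ∏ e : G.edgeFinset, bondSpin σ (e : Sym2 V) ^ n e := by
            rw [Finset.mul_sum]; exact Finset.sum_congr rfl fun σ _ => by ring
        _ = (2 : ℝ) ^ Fintype.card V * (if Current.sources n = A then Current.wweight K n else 0) := by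
            rw [h]; split_ifs <;> ring
    simp_rw [hre]
    exact (tendsto_sum_piFinset_of_summable G (Current.summable_wweight_indicator hK _)).const_mul _
  exact tendsto_nhds_unique h1 h2

omit [DecidableRel G.Adj] in
/-- The tree's uniform current sum is the weighted one of the constant coupling (parallel to
`Current.weight_eq_wweight`). [folklore] -/
theorem currentSum_eq_wcurrentSum [DecidableRel G.Adj] (β : ℝ) (A : Finset V) :
    currentSum G β A = wcurrentSum (fun _ : G.edgeFinset => β) A := rfl

/-- `Z_K[A] ≥ 0` (real form, `K ≥ 0`). [folklore] -/
theorem wcurrentSum_nonneg {K : G.edgeFinset → ℝ} (hK : ∀ e, 0 ≤ K e) (A : Finset V) : 0 ≤ wcurrentSum K A :=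
  tsum_nonneg fun n => by
    split_ifs
    · exact Current.wweight_nonneg hK n
    · exact le_rfl

/-- The `ℝ≥0∞` current sum is the cast of the real one (`K ≥ 0`). [folklore] -/
theorem ecurrentSum_eq_ofReal {K : G.edgeFinset → ℝ} (hK : ∀ e, 0 ≤ K e) (A : Finset V) :
    ecurrentSum K A = ENNReal.ofReal (wcurrentSum K A) := by
  unfold ecurrentSum wcurrentSum
  rw [ENNReal.ofReal_tsum_of_nonneg (fun n => ?_) (Current.summable_wweight_indicator hK _)]
  · refine tsum_congr fun n => ?_
    unfold Current.eweight
    split_ifs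
    · rfl
    · exact ENNReal.ofReal_zero.symm
  · split_ifs
    · exact Current.wweight_nonneg hK n
    · exact le_rfl

/-- `(Z_K[A] : ℝ≥0∞).toReal = Z_K[A]`. [folklore] -/
theorem toReal_ecurrentSum {K : G.edgeFinset → ℝ} (hK : ∀ e, 0 ≤ K e) (A : Finset V) :
    (ecurrentSum K A).toReal = wcurrentSum K A := by
  rw [ecurrentSum_eq_ofReal hK, ENNReal.toReal_ofReal (wcurrentSum_nonneg hK A)]

/-- `Z_K[A] < ∞` in `ℝ≥0∞`. [folklore] -/
theorem ecurrentSum_ne_top {K : G.edgeFinset → ℝ} (hK : ∀ e, 0 ≤ K e) (A : Finset V) : ecurrentSum K A ≠ ∞ := by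
  rw [ecurrentSum_eq_ofReal hK]
  exact ENNReal.ofReal_ne_top

/-- `Z_{G₁,K}[A] < ∞`. [folklore] -/
theorem ecurrentSumIn_ne_top (G₁ : SimpleGraph V) [DecidableRel G₁.Adj] {K : G.edgeFinset → ℝ}
    (hK : ∀ e, 0 ≤ K e) (A : Finset V) : ecurrentSumIn G₁ K A ≠ ∞ :=
  ne_top_of_le_ne_top (ecurrentSum_ne_top hK A) (ecurrentSumIn_le G₁ K A)

/-- `0 < Z_K[∅]` (real). [folklore] -/
theorem wcurrentSum_empty_pos {K : G.edgeFinset → ℝ} (hK : ∀ e, 0 ≤ K e) : 0 < wcurrentSum K (∅ : Finset V) := by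
  rw [← toReal_ecurrentSum hK]
  exact ENNReal.toReal_pos (ecurrentSum_empty_ne_zero K) (ecurrentSum_ne_top hK ∅)

end Dictionary

end Literature.Probability.LatticeModels

end
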